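import Literature.AlgebraicGeometry.Resolution.ModelBadPoints
import Literature.AlgebraicGeometry.Resolution.TowerQuadraticTransform
import Literature.AlgebraicGeometry.Resolution.BaseTreeFinite
import Literature.AlgebraicGeometry.Resolution.PatchingStepFive
import Literature.AlgebraicGeometry.Resolution.QuadraticTransformsFactorization
import HarnessLib

/-!
# Zariski's bad-curve induction for `P = P_reg`: the step

Topic: `Literature/AlgebraicGeometry/Resolution`. The inductive step of Zariski's patching of two
projective models `η : B → A` of a function field `K/k` of transcendence degree three over an open
`U ⊆ Reg A` (Zariski–Samuel II, Ch. VI §17; Piltant 2013, proof of Prop. 5.1, Lemma 5.6), in the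
form WITHOUT Piltant's factorizability Lemma 5.3: given a BAD point `x` (`ProjModel.IsBad`: a
point of `U` whose local ring has no centre on `B` and whose closure leaves `U`; then
`dim 𝒪_{A,x} = 2`), principalize the ideal of the curve `cl{x} ∩ U` by a Cossart–Piltant sequence
(`CossartPiltant2019Principalization`), extend it to a modification `ρ : A' → A`
(`exists_extension_full`), and let `B' := J(N₂, A')` be the join with the model `N₂ → B` of
Step 2 for the pair `(A', B)` (`exists_hom_regLe_isIso_of_regPrincipalization`). Then
`B' → B` has `Reg B` regular preimage, `U' = ρ⁻¹(U) ⊆ Reg A'`, and the MEASURE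
`Σ_{a bad} #{iterated quadratic transforms of 𝒪_{A,a} without centre on B}` drops
(`badMeasure_step_lt`): over `x` the new model `A'` realizes exactly first quadratic transforms of
`𝒪_{A,x}` (`TowerQuadraticTransform.lean`), regular points of `B` over `x` are no points of
indeterminacy of `B ⋯→ A'` (Abhyankar's factorization `AbhyankarQuadraticFactorization_holds` and
the valuation rings at points with `dim 𝒪 ≤ 1`), so that centres on `B` of local rings over `x`
or off `cl{x}` transfer to `B'`, and the base-tree recursion
(`sum_baseCount_add_one_le`, `finite_baseTree`) bounds the new bad points over `x`. All PROVED;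
the only input which is not a theorem of the tree is the hypothesis
`hP : CossartPiltant2019Principalization`.

## References

* O. Zariski, P. Samuel, *Commutative Algebra* II (1960), Ch. VI §17, "Fundamental theorem"
  p. 539. [ZariskiSamuel1960]
* O. Piltant, RACSAM 107 (2013), proof of Prop. 5.1 (Steps 3–4, Lemma 5.6). [Piltant2013]
* V. Cossart, O. Piltant, J. Algebra 529 (2019), Prop. 4.4 and proof of Prop. 4.6.
  [CossartPiltant2019]
* S. S. Abhyankar, Ann. of Math. 63 (1956), Thm. 3 (factorization through quadratic transforms).
  [Cutkosky2014]
-/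

noncomputable section

open CategoryTheory CategoryTheory.Limits AlgebraicGeometry TopologicalSpace IsLocalRing Order
open Literature.AlgebraicGeometry.Motives
open Scheme.IdealSheafData

universe u

namespace Literature.AlgebraicGeometry.Resolution

attribute [local instance] MvPolynomial.gradedAlgebra

namespace ProjModel

variable {k K : Type u} [Field k] [Field K] [Algebra k K]

/-! ## Transfer of centres to a join along a local isomorphism -/

/-- **Centres transfer to the join along local isomorphisms**: if `ψ : N₂ → B` is an isomorphism
over an open `V ∋ t`, `t` a centre of the local ring `𝔬` on `B`, and `𝔬` has a centre on `A'`,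
then `𝔬` has a centre on the join `J(N₂, A')`. [cite: ZariskiSamuel1960, Ch. VI §17] -/
theorem hasCentre_join_of_isIso_morphismRestrict {N₂ A' B : ProjModel k K} (ψ : N₂.Hom B)
    {O : Subring K} [IsLocalRing O] {t : B.X} (ht : B.IsCentreOf O t) (V : B.X.Opens) (htV : t ∈ V)
    [IsIso (ψ.f ∣_ V)] (hA' : A'.HasCentre O) : (join N₂ A').HasCentre O := by
  obtain ⟨y, hy⟩ := (ψ.f ∣_ V).surjective ⟨t, htV⟩
  let n₂ : N₂.X := (ψ.f ⁻¹ᵁ V).ι y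
  have hn₂ : ψ.f n₂ = t := by
    have h1 : V.ι ((ψ.f ∣_ V) y) = t := by rw [hy]; rfl
    rw [← h1]
    change ((ψ.f ⁻¹ᵁ V).ι ≫ ψ.f) y = ((ψ.f ∣_ V) ≫ V.ι) y
    rw [morphismRestrict_ι]
  haveI := isIso_stalkMap_of_isIso_morphismRestrict ψ.f V n₂ (by rw [hn₂]; exact htV)
  have hN₂ : N₂.IsCentreOf O n₂ := by
    unfold IsCentreOf
    rw [← stalkSubring_eq_of_isIso_stalkMap ψ n₂, hn₂]
    exact ht
  exact hasCentre_join ⟨n₂, hN₂⟩ hA'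

/-! ## The measure: iterated quadratic transforms without centre -/

/-- **The bad tree of `R` with respect to `B`**: the iterated quadratic transforms of the local
ring `R ⊆ K` which have no centre on `B` (with homogeneous coordinates `w` of `gen_B` this is the
base tree `baseTree R w` of `(w₀ : … : wₙ)`, `badTree_eq_baseTree`). [cite: ZariskiSamuel1960, Appendix 5] -/
def badTree (B : ProjModel k K) (R : Subring K) : Set (Subring K) :=
  {R' | Relation.ReflTransGen IsQuadraticTransform R R' ∧ ¬ B.HasCentre R'}

/-- The number of iterated quadratic transforms of `R` without centre on `B` (`0` if infinite).
[cite: Piltant2013, Def. 5.2 (`n_x`)] -/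
def badCount (B : ProjModel k K) (R : Subring K) : ℕ :=
  (badTree B R).ncard

/-- **The bad tree is the base tree of the homogeneous coordinates of `gen_B`.**
[cite: ZariskiSamuel1960, Ch. VI §17] -/
theorem badTree_eq_baseTree (B : ProjModel k K) {n : ℕ}
    (ιB : B.X ⟶ Proj (Segre.grading (Fin (n + 1)) k)) [IsClosedImmersion ιB]
    (hιB : ιB ≫ Segre.toSpec (Fin (n + 1)) k = B.π) (w : Fin (n + 1) → K) (hw : w ≠ 0)
    (hgenB : B.gen ≫ ιB = (ProjectiveSpace.pointOfVec k w hw).left) {R : Subring K} [IsLocalRing R]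
    (hk : ∀ c : k, algebraMap k K c ∈ R) : badTree B R = baseTree R w := by
  ext R'
  simp only [badTree, Set.mem_setOf_eq, mem_baseTree_iff]
  refine and_congr_right fun h => not_congr ?_
  haveI := isLocalRing_of_reflTransGen h
  exact hasCentre_iff_definedOn B ιB hιB w hw hgenB
    (fun c => (subringDominates_of_reflTransGen h).1 (hk c))

/-- `badCount = baseCount`. [folklore] -/
theorem badCount_eq_baseCount (B : ProjModel k K) {n : ℕ}
    (ιB : B.X ⟶ Proj (Segre.grading (Fin (n + 1)) k)) [IsClosedImmersion ιB]
    (hιB : ιB ≫ Segre.toSpec (Fin (n + 1)) k = B.π) (w : Fin (n + 1) → K) (hw : w ≠ 0)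
    (hgenB : B.gen ≫ ιB = (ProjectiveSpace.pointOfVec k w hw).left) {R : Subring K} [IsLocalRing R]
    (hk : ∀ c : k, algebraMap k K c ∈ R) : badCount B R = baseCount R w := by
  rw [badCount, badTree_eq_baseTree B ιB hιB w hw hgenB hk]; rfl

/-- **Monotonicity**: if every iterated quadratic transform of `R` with a centre on `B` has one on
`B'`, the bad tree for `B'` is contained in the one for `B`. [folklore] -/
theorem badTree_subset {B B' : ProjModel k K} {R : Subring K}
    (h : ∀ R', Relation.ReflTransGen IsQuadraticTransform R R' → B.HasCentre R' → B'.HasCentre R') :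
    badTree B' R ⊆ badTree B R :=
  fun R' ⟨h1, h2⟩ => ⟨h1, fun h3 => h2 (h R' h1 h3)⟩

/-- The corresponding inequality of counts (for a finite bad tree). [folklore] -/
theorem badCount_le {B B' : ProjModel k K} {R : Subring K} (hfin : (badTree B R).Finite)
    (h : ∀ R', Relation.ReflTransGen IsQuadraticTransform R R' → B.HasCentre R' → B'.HasCentre R') :
    badCount B' R ≤ badCount B R :=
  Set.ncard_le_ncard (badTree_subset h) hfin

/-- **The measure of a state** `(A, U, B)`: the total number of iterated quadratic transforms
without centre on `B` of the local rings of the bad points (Piltant's `N_η = Σ_x n_x` for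
`P = P_reg`, with `n_x` replaced by the base count). [cite: Piltant2013, Lemma 5.6 (proof)] -/
def badMeasure (A : ProjModel k K) (U : A.X.Opens) (B : ProjModel k K) : ℕ :=
  ∑ᶠ a ∈ {a : A.X | IsBad A B U a}, badCount B (A.stalkSubring a)

/-! ## The local ring at a bad point -/

section LocalRing

variable (A : ProjModel k K)

/-- `𝒪_{A,a} ⊆ K` is regular when `𝒪_{A,a}` is. [folklore] -/
instance isRegularLocalRing_stalkSubring (a : A.X) [IsRegularLocalRing (A.X.presheaf.stalk a)] :
    IsRegularLocalRing (A.stalkSubring a) :=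
  IsRegularLocalRing.of_ringEquiv (A.stalkEquiv a)

/-- `dim (𝒪_{A,a} ⊆ K) = dim 𝒪_{A,a} = coheight a`. [folklore] -/
theorem ringKrullDim_stalkSubring (a : A.X) :
    ringKrullDim (A.stalkSubring a) = coheight a := by
  rw [← ringKrullDim_stalk_eq_coheight, ringKrullDim_eq_of_ringEquiv (A.stalkEquiv a)]

/-- `dim 𝒪_{A,a} = 2` in the form consumed by the quadratic-transform library. [folklore] -/
theorem ringKrullDim_stalkSubring_eq_two {a : A.X} (ha : coheight a = 2) :
    ringKrullDim (A.stalkSubring a) = 2 := by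
  rw [ringKrullDim_stalkSubring, ha]; rfl

/-- **The residue field of a non-closed point is infinite**: `κ(a) ⊇ Γ(V)/𝔭_V(a)`, an affine
domain of dimension `dim cl{a} ≥ 1`, and a finite domain is a field. [folklore] -/
theorem infinite_residueField_stalk {a : A.X} (ha : height a ≠ 0) :
    Infinite (ResidueField (A.X.presheaf.stalk a)) := by
  obtain ⟨_, ⟨V, hV, rfl⟩, haV, -⟩ :=
    A.X.isBasis_affineOpens.exists_subset_of_mem_open (Set.mem_univ a) isOpen_univ
  let 𝔭 := hV.primeIdealOf ⟨a, haV⟩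
  letI : Algebra Γ(A.X, V) (A.X.presheaf.stalk a) :=
    TopCat.Presheaf.algebra_section_stalk A.X.presheaf (⟨a, haV⟩ : V)
  haveI : IsLocalization.AtPrime (A.X.presheaf.stalk a) 𝔭.asIdeal := hV.isLocalization_stalk ⟨a, haV⟩
  -- `Γ(V)/𝔭` is infinite: a domain of dimension `height a ≠ 0` is not a field
  have hdim := Literature.AlgebraicGeometry.Dimension.Scheme.height_eq_ringKrullDim_quotient_primeIdealOf
    A.π hV haV
  have hinf : Infinite (Γ(A.X, V) ⧸ 𝔭.asIdeal) := by
    by_contra hfin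
    rw [not_infinite_iff_finite] at hfin
    have hF : IsField (Γ(A.X, V) ⧸ 𝔭.asIdeal) := Finite.isField_of_domain _
    have h0 := ringKrullDim_eq_zero_of_isField hF
    rw [h0] at hdim
    exact ha (by exact_mod_cast hdim)
  -- `Γ(V)/𝔭 ↪ κ(a)`
  let f : Γ(A.X, V) →+* ResidueField (A.X.presheaf.stalk a) :=
    (residue _).comp (algebraMap Γ(A.X, V) (A.X.presheaf.stalk a))
  have hker : RingHom.ker f = 𝔭.asIdeal := by
    change RingHom.ker ((residue _).comp (algebraMap Γ(A.X, V) (A.X.presheaf.stalk a))) = _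
    rw [← RingHom.comap_ker, ker_residue]
    exact IsLocalization.AtPrime.under_maximalIdeal (A.X.presheaf.stalk a) 𝔭.asIdeal
  have hf : ∀ r ∈ 𝔭.asIdeal, f r = 0 := fun r hr => by
    rw [← RingHom.mem_ker, hker]; exact hr
  have hinj : Function.Injective (Ideal.Quotient.lift 𝔭.asIdeal f hf) :=
    (Ideal.injective_lift_iff hf).mpr hker
  exact Infinite.of_injective _ hinj

/-- The residue field of `𝒪_{A,a} ⊆ K` at a non-closed point is infinite. [folklore] -/
theorem infinite_residueField_stalkSubring {a : A.X} (ha : height a ≠ 0) :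
    Infinite (ResidueField (A.stalkSubring a)) := by
  haveI := A.infinite_residueField_stalk ha
  haveI : IsLocalHom (A.stalkEquiv a).toRingHom :=
    ⟨fun t ht => (MulEquiv.isUnit_map (A.stalkEquiv a)).mp ht⟩
  exact Infinite.of_injective (ResidueField.map (A.stalkEquiv a).toRingHom)
    (ResidueField.map (A.stalkEquiv a).toRingHom).injective

/-- A bad point has `height = 1`. [folklore] -/
theorem IsBad.height_eq_one (htr : Algebra.trdeg k K = 3) {B : ProjModel k K} {U : A.X.Opens}
    (hU : (U : Set A.X) ⊆ Scheme.regularLocus A.X) {a : A.X} (h : IsBad A B U a) : height a = 1 := by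
  have h2 := h.coheight_eq_two htr hU
  obtain ⟨c, h', hc, hh, hsum⟩ := A.exists_nat_coheight_height htr a
  rw [hc] at h2
  have : c = 2 := by exact_mod_cast h2
  rw [hh]; exact_mod_cast (by omega : h' = 1)

/-- **The bad tree at a bad point is finite** (finiteness of the base tree, Zariski–Samuel II
App. 5, over the regular two-dimensional local ring `𝒪_{A,x}` with infinite residue field).
[cite: ZariskiSamuel1960, Appendix 5] -/
theorem IsBad.finite_badTree (htr : Algebra.trdeg k K = 3) {B : ProjModel k K} {U : A.X.Opens}
    (hU : (U : Set A.X) ⊆ Scheme.regularLocus A.X) {x : A.X} (hx : IsBad A B U x) :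
    (badTree B (A.stalkSubring x)).Finite := by
  obtain ⟨n, ιB, _, hιB, w, hw, hgenB⟩ := B.exists_coords
  haveI := isRegularLocalRing_of_mem hU hx.1
  rw [badTree_eq_baseTree B ιB hιB w hw hgenB (A.algebraMap_mem_stalkSubring x)]
  have hw' : ∃ i, w i ≠ 0 := by
    by_contra h; push Not at h; exact hw (funext h)
  exact finite_baseTree (A.ringKrullDim_stalkSubring_eq_two (hx.coheight_eq_two htr hU))
    (A.isLocalRingOf_stalkSubring x)
    (A.infinite_residueField_stalkSubring (by rw [hx.height_eq_one A htr hU]; exact one_ne_zero)) w hw'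

end LocalRing

/-! ## The modification `ρ : A' → A` principalizing the ideal of the bad curve -/

section Modification

variable {A B : ProjModel k K} {U : A.X.Opens} {x : A.X}

/-- **The modification at a bad point.** Principalizing the ideal of the curve `cl{x} ∩ U` on `U`
by a Cossart–Piltant sequence and extending it to `A` gives a morphism of projective models
`ρ : A' → A` such that: `ρ⁻¹(U) ⊆ Reg A'`; `ρ` is an isomorphism over an open containing
`A ∖ cl{x}`; and the local rings of `A'` at the points over `x` are first quadratic transforms of
`𝒪_{A,x}` (Zariski: "blowing up the curve through `x` is, over `Spec 𝒪_{A,x}`, the blowing up of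
its closed point"). [cite: Piltant2013, Lemma 5.6 (proof)] -/
theorem exists_modification_of_isBad (hP : CossartPiltant2019Principalization.{u})
    (htr : Algebra.trdeg k K = 3) (hU : (U : Set A.X) ⊆ Scheme.regularLocus A.X)
    (hx : IsBad A B U x) :
    ∃ (A' : ProjModel k K) (ρ : A'.Hom A) (V : A.X.Opens),
      (∀ a' : A'.X, ρ.f a' ∈ U → IsRegularLocalRing (A'.X.presheaf.stalk a')) ∧
      (closure ({x} : Set A.X))ᶜ ⊆ (V : Set A.X) ∧ IsIso (ρ.f ∣_ V) ∧
      (∀ a' : A'.X, ρ.f a' = x →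
        IsQuadraticTransform (A.stalkSubring x) (A'.stalkSubring a')) := by
  classical
  have hxU : x ∈ U := hx.1
  have hx2 : coheight x = 2 := hx.coheight_eq_two htr hU
  haveI hregx : IsRegularLocalRing (A.X.presheaf.stalk x) := isRegularLocalRing_of_mem hU hxU
  have hdimx : ringKrullDim (A.X.presheaf.stalk x) = 2 := by
    rw [ringKrullDim_stalk_eq_coheight, hx2]; rfl
  /- (1) the open subscheme `U` and the point `x' ∈ U` -/
  haveI : Nonempty (U : Scheme.{u}) := ⟨⟨x, hxU⟩⟩
  have hUne : (U : Set A.X).Nonempty := ⟨x, hxU⟩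
  haveI hintU : IsIntegral (U : Scheme.{u}) := isIntegral_of_isOpenImmersion U.ι
  have hregU : Scheme.IsRegular (U : Scheme.{u}) := fun y => by
    have hy : (U.ι y) ∈ Scheme.regularLocus A.X := hU (by rw [Scheme.Opens.ι_apply]; exact y.2)
    haveI : IsRegularLocalRing (A.X.presheaf.stalk (U.ι y)) := hy
    exact IsRegularLocalRing.of_ringEquiv (asIso (U.ι.stalkMap y)).commRingCatIsoToRingEquiv
  let x' : (U : Scheme.{u}) := ⟨x, hxU⟩
  have hx' : U.ι x' = x := rfl
  haveI hregx' : IsRegularLocalRing ((U : Scheme.{u}).presheaf.stalk x') := hregU x'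
  have hdimx' : ringKrullDim ((U : Scheme.{u}).presheaf.stalk x') = 2 := by
    rw [← hdimx]; exact (ringKrullDim_eq_of_ringEquiv (asIso (U.ι.stalkMap x')).commRingCatIsoToRingEquiv).symm
  /- (2) the ideal of the curve and its principalization -/
  let J : (U : Scheme.{u}).IdealSheafData := curveIdeal x'
  have hJ : J ≠ ⊥ := by
    intro hbot
    have h1 : stalkIdeal J x' = ⊥ := by rw [hbot, stalkIdeal_bot]
    have h2 : stalkIdeal J x' = maximalIdeal _ := stalkIdeal_vanishingIdeal_closure_self x'
    rw [h2] at h1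
    have hfield : IsField ((U : Scheme.{u}).presheaf.stalk x') :=
      (IsLocalRing.isField_iff_maximalIdeal_eq).mpr h1
    have := ringKrullDim_eq_zero_of_isField hfield
    rw [hdimx'] at this
    exact absurd this (by decide)
  have hdimA : topologicalKrullDim A.X = 3 := by rw [A.topologicalKrullDim_eq_of_trdeg htr]; rfl
  obtain ⟨S', σ, hσ, hlp⟩ := principalization_opens_of_principalization hP A hdimA U hU hUne J hJ
  haveI hS'noeth : IsLocallyNoetherian S' :=
    haveI := hσ.isProper stacks02NS_holds inferInstance
    LocallyOfFiniteType.isLocallyNoetherian σ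
  /- (3) chart presentations over `x'` (the tower lemma) -/
  have hcp : ∀ s' : S', σ s' = x' → ChartPresentation σ s' :=
    hσ.chartPresentation_of_isLocallyPrincipalAt hdimx' (fun s' _ => hlp s')
  /- (4) extension to `A` -/
  obtain ⟨X', ρ, j', hj', hpb, hprop, hint, hbir, hproj, hregS', hsurj, hiso⟩ :=
    hσ.exists_extension_full hregU hJ U.ι
  haveI := hj'
  haveI := hint
  haveI := hprop
  haveI := hiso
  have hproj' : Motives.IsProjectiveOver (Over.mk (ρ ≫ A.π) : Motives.SchemeOver k) :=
    hproj k A.π A.isProjectiveOver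
  /- (5) the modification model -/
  let V : A.X.Opens := principalOpen U.ι J
  have hVsub : (closure ({x} : Set A.X))ᶜ ⊆ (V : Set A.X) := by
    rw [coe_principalOpen, Set.compl_subset_compl]
    refine closure_minimal ?_ isClosed_closure
    rintro _ ⟨s, hs, rfl⟩
    have hs' : s ∈ (J.support : Set U) := nonPrincipalLocus_le_support J hs
    rw [support_curveIdeal] at hs'
    have h1 : U.ι '' closure ({x'} : Set U) ⊆ closure (U.ι '' {x'}) :=
      image_closure_subset_closure_image U.ι.continuous
    rw [Set.image_singleton, hx'] at h1
    exact h1 ⟨s, hs', rfl⟩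
  have hVne : (V : Set A.X).Nonempty := by
    refine ⟨genericPoint A.X, hVsub ?_⟩
    intro hgen
    -- the generic point is not in the closure of `x` (it would equal `x`, which is bad)
    have h1 : x ⤳ genericPoint A.X := specializes_iff_mem_closure.mpr hgen
    have h2 : genericPoint A.X ⤳ x := (genericPoint_spec A.X).specializes (Set.mem_univ x)
    have heq : x = genericPoint A.X := (h1.antisymm h2).eq
    apply hx.2.1
    rw [heq, stalkSubring_genericPoint]
    exact B.hasCentre_top
  let A' : ProjModel k K := ofModification A ρ V hVne hproj'
  let ρA : A'.Hom A := ofModificationHom A ρ V hVne hproj'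
  have hρA : ρA.f = ρ := rfl
  refine ⟨A', ρA, V, fun a' ha' => ?_, hVsub, hiso, fun a' ha' => ?_⟩
  · -- regularity over `U`: the point comes from the regular scheme `S'`
    obtain ⟨s', rfl⟩ := hsurj a' ⟨⟨ρ a', ha'⟩, rfl⟩
    haveI : IsRegularLocalRing (S'.presheaf.stalk s') := hregS' s'
    exact IsRegularLocalRing.of_ringEquiv (asIso (j'.stalkMap s')).commRingCatIsoToRingEquiv.symm
  · -- points over `x`: first quadratic transforms
    obtain ⟨s', rfl⟩ := hsurj a' ⟨x', by rw [hx']; exact ha'.symm⟩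
    have hw : j' ≫ ρA.f = σ ≫ U.ι := hpb.w
    have hs' : σ s' = x' := by
      apply U.ι.isOpenEmbedding.injective
      rw [← Scheme.Hom.comp_apply, ← hw, Scheme.Hom.comp_apply, hx']
      exact ha'
    haveI : IsIso (@Scheme.Hom.stalkMap S' A'.X j' s') := by
      exact (inferInstance : IsIso (j'.stalkMap s'))
    haveI : IsRegularLocalRing (A.X.presheaf.stalk (U.ι (σ s'))) := by rw [hs', hx']; exact hregx
    have h := isQuadraticTransform_stalkSubring_of_chartPresentation ρA U σ j' hw s' (hcp s' hs')
      (hx2 := by rw [hs', hx']; exact hdimx)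
    rw [hs'] at h
    exact h

end Modification

/-! ## Avoidance: regular points of `B` over `x` are no points of indeterminacy of `B ⋯→ A'` -/

section Avoidance

variable (htr : Algebra.trdeg k K = 3) {A A' B : ProjModel k K} (η : B.Hom A) (ρ : A'.Hom A)
  {U : A.X.Opens} (hU : (U : Set A.X) ⊆ Scheme.regularLocus A.X) {x : A.X} (hx : IsBad A B U x)
  (hqt : ∀ a' : A'.X, ρ.f a' = x → IsQuadraticTransform (A.stalkSubring x) (A'.stalkSubring a'))
  {V : A.X.Opens} (hV : (closure ({x} : Set A.X))ᶜ ⊆ (V : Set A.X)) [IsIso (ρ.f ∣_ V)]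

omit [IsIso (ρ.f ∣_ V)] in
/-- Over the isomorphism locus `V` of `ρ` every point has a preimage at which `ρ` is a local
isomorphism. [folklore] -/
theorem exists_preimage_isIso_stalkMap [IsIso (ρ.f ∣_ V)] {a : A.X} (ha : a ∈ V) :
    ∃ a' : A'.X, ρ.f a' = a ∧ IsIso (ρ.f.stalkMap a') := by
  obtain ⟨y, hy⟩ := (ρ.f ∣_ V).surjective ⟨a, ha⟩
  let a' : A'.X := (ρ.f ⁻¹ᵁ V).ι y
  have ha' : ρ.f a' = a := by
    have h1 : V.ι ((ρ.f ∣_ V) y) = a := by rw [hy]; rfl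
    rw [← h1]
    change ((ρ.f ⁻¹ᵁ V).ι ≫ ρ.f) y = ((ρ.f ∣_ V) ≫ V.ι) y
    rw [morphismRestrict_ι]
  exact ⟨a', ha', isIso_stalkMap_of_isIso_morphismRestrict ρ.f V a' (by rw [ha']; exact ha)⟩

include ρ hV in
/-- **Points of `B` off `cl{x}` are no points of indeterminacy of `B ⋯→ A'`** (`ρ` is an
isomorphism there). [cite: Piltant2013, Lemma 5.6 (proof)] -/
theorem hasCentre_of_not_mem_closure {m : B.X} (hm : η.f m ∉ closure ({x} : Set A.X)) :
    A'.HasCentre (B.stalkSubring m) := by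
  obtain ⟨a', ha', hiso⟩ := exists_preimage_isIso_stalkMap ρ (hV hm)
  haveI := hiso
  refine ⟨a', ?_⟩
  unfold IsCentreOf
  rw [← stalkSubring_eq_of_isIso_stalkMap ρ a', ha']
  exact stalkSubring_dominates_of_hom η m

include htr hU hx hqt in
/-- **Regular points of `B` over `x` are no points of indeterminacy of `B ⋯→ A'`.** The local
ring `S = 𝒪_{B,m}` is regular of dimension `≤ 2` dominating `R = 𝒪_{A,x}`: if `dim S ≤ 1` it is a
valuation ring; if `dim S = 2`, Abhyankar's factorization gives `R = R₀ → R₁ → ⋯ → R_n = S`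
through quadratic transforms with `n ≥ 1` (as `x` is bad), and the first one `R₁` is the local
ring of the centre on `A'` of a valuation ring dominating `S` (uniqueness of the quadratic
transform dominated by a local ring), so `S` dominates `𝒪_{A',a''} = R₁`.
[cite: Piltant2013, Lemma 5.6 (proof); Cutkosky2014, Thm. 2.1] -/
theorem hasCentre_of_map_eq_of_isRegularLocalRing {m : B.X} (hm : η.f m = x)
    [IsRegularLocalRing (B.X.presheaf.stalk m)] : A'.HasCentre (B.stalkSubring m) := by
  have hx2 : coheight x = 2 := hx.coheight_eq_two htr hU
  haveI hregx : IsRegularLocalRing (A.X.presheaf.stalk x) := isRegularLocalRing_of_mem hU hx.1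
  set R := A.stalkSubring x with hR
  set S := B.stalkSubring m with hS
  have hdomRS : SubringDominates R S := by
    rw [hR, ← hm]; exact stalkSubring_dominates_of_hom η m
  have hm2 : coheight m ≤ 2 := coheight_le_two_of_map_eq htr η hx2 hm
  by_cases hm1 : coheight m ≤ 1
  · exact hasCentre_of_coheight_le_one B A' hm1
  have hm2' : coheight m = 2 := by
    obtain ⟨c, h, hc, -, -⟩ := B.exists_nat_coheight_height htr m
    rw [hc] at hm1 hm2 ⊢
    have h1 : ¬ c ≤ 1 := fun h' => hm1 (by exact_mod_cast h')
    have h2 : c ≤ 2 := by exact_mod_cast hm2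
    exact_mod_cast (by omega : c = 2)
  have hR2 : ringKrullDim R = 2 := A.ringKrullDim_stalkSubring_eq_two hx2
  have hS2 : ringKrullDim S = 2 := B.ringKrullDim_stalkSubring_eq_two hm2'
  have hchain : Relation.ReflTransGen IsQuadraticTransform R S :=
    AbhyankarQuadraticFactorization_holds K R S inferInstance hR2 (A.isLocalRingOf_stalkSubring x)
      inferInstance hS2 hdomRS
  rcases reflTransGen_iff_eq_or_exists_head.mp hchain with heq | ⟨R₁, hR₁, hR₁S⟩
  · -- `S = R`: then `m` would be a centre of `𝒪_{A,x}` on `B`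
    exact absurd ⟨m, show SubringDominates S R by rw [heq]; exact SubringDominates.refl _⟩ hx.2.1
  · -- a valuation ring `W` dominating `S`, its centre `a''` on `A'`
    obtain ⟨W, hW⟩ := (LocalSubring.mk S).exists_le_valuationSubring
    haveI : IsLocalRing W.toSubring := inferInstanceAs (IsLocalRing W)
    have hSW : SubringDominates S W.toSubring := (subringDominates_iff S W.toSubring).mpr hW
    let v : ZariskiRiemannSpace k K :=
      ⟨W, fun c => hSW.1 (hdomRS.1 (A.algebraMap_mem_stalkSubring x c))⟩
    let a'' : A'.X := A'.centre v
    have hA'' : A'.IsCentreOf W.toSubring a'' := A'.isCentreOf_centre v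
    have hρa'' : ρ.f a'' = x :=
      (hA''.map ρ).unique (show A.IsCentreOf W.toSubring x from hdomRS.trans hSW)
    have hO'' : IsQuadraticTransform R (A'.stalkSubring a'') := hqt a'' hρa''
    haveI := hR₁.isLocalRing
    have hdom2 : SubringDominates R₁ W.toSubring := (subringDominates_of_reflTransGen hR₁S).trans hSW
    have heq : A'.stalkSubring a'' = R₁ :=
      IsQuadraticTransform.eq_of_dominated hO'' hR₁ ⟨inferInstance, IsNoetherian.noetherian _⟩
        hA'' hdom2
    exact ⟨a'', show SubringDominates (A'.stalkSubring a'') S by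
      rw [heq]; exact subringDominates_of_reflTransGen hR₁S⟩

include htr hU hx hqt hV in
/-- **The regular points of indeterminacy of `B ⋯→ A'` lie over `cl{x} ∖ {x}`.**
[cite: Piltant2013, Lemma 5.6 (proof)] -/
theorem setOf_not_hasCentre_inter_regularLocus_subset :
    {m : B.X | ¬ A'.HasCentre (B.stalkSubring m)} ∩ Scheme.regularLocus B.X ⊆
      {m | η.f m ∈ closure ({x} : Set A.X) ∧ η.f m ≠ x} := by
  rintro m ⟨hm, hreg⟩
  haveI : IsRegularLocalRing (B.X.presheaf.stalk m) := hreg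
  refine ⟨?_, fun h => hm (hasCentre_of_map_eq_of_isRegularLocalRing htr η ρ hU hx hqt h)⟩
  by_contra h
  exact hm (hasCentre_of_not_mem_closure η ρ hV h)

include htr hU hx hqt hV in
/-- **… and so does the closure of this set** (generic points of its closure lie in it, the
regular locus being open). [cite: Piltant2013, Lemma 5.6 (proof)] -/
theorem closure_setOf_not_hasCentre_inter_regularLocus_subset :
    closure ({m : B.X | ¬ A'.HasCentre (B.stalkSubring m)} ∩ Scheme.regularLocus B.X) ⊆
      {m | η.f m ∈ closure ({x} : Set A.X) ∧ η.f m ≠ x} := by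
  have hqe : Scheme.IsQuasiExcellent B.X :=
    (Scheme.isExcellent_of_locallyOfFiniteType Stacks07QW_field_holds B.π).isQuasiExcellent
  obtain ⟨W, hW⟩ := Scheme.exists_opens_coe_eq_regularLocus hqe
  rw [← hW]
  intro t ht
  obtain ⟨ξ, hξ, hξt⟩ :=
    exists_mem_inter_specializes_of_mem_closure (isClosed_setOf_not_hasCentre B A') W.isOpen ht
  rw [hW] at hξ
  obtain ⟨hξC, hξx⟩ := setOf_not_hasCentre_inter_regularLocus_subset htr η ρ hU hx hqt hV hξ
  have hηξt : η.f ξ ⤳ η.f t := hξt.map η.f.continuous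
  have htC : η.f t ∈ closure ({x} : Set A.X) :=
    closure_minimal (Set.singleton_subset_iff.mpr hξC) isClosed_closure
      (specializes_iff_mem_closure.mp hηξt)
  refine ⟨htC, fun htx => hξx ?_⟩
  rw [htx] at hηξt
  exact (hηξt.antisymm (specializes_iff_mem_closure.mpr hξC)).eq

include htr hU hx hqt hV in
/-- **Transfer of centres from `B` to `B' = J(N₂, A')`**: if `ψ : N₂ → B` is an isomorphism over
every open missing the closure of the regular indeterminacy locus of `B ⋯→ A'` (the conclusion of
Step 2), then a local ring with a centre `t` on `B` NOT over `cl{x} ∖ {x}` and a centre on `A'`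
has a centre on the join. [cite: Piltant2013, Lemma 5.6 (proof)] -/
theorem hasCentre_join_of_isCentreOf {N₂ : ProjModel k K} (ψ : N₂.Hom B)
    (hiso : ∀ W : B.X.Opens, Disjoint (W : Set B.X)
      (closure ({m : B.X | ¬ A'.HasCentre (B.stalkSubring m)} ∩ Scheme.regularLocus B.X)) →
        IsIso (ψ.f ∣_ W))
    {O : Subring K} [IsLocalRing O] {t : B.X} (ht : B.IsCentreOf O t)
    (hηt : ¬ (η.f t ∈ closure ({x} : Set A.X) ∧ η.f t ≠ x)) (hA' : A'.HasCentre O) :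
    (join N₂ A').HasCentre O := by
  let W : B.X.Opens :=
    ⟨(closure ({m : B.X | ¬ A'.HasCentre (B.stalkSubring m)} ∩ Scheme.regularLocus B.X))ᶜ,
      isClosed_closure.isOpen_compl⟩
  have htW : t ∈ W := fun h =>
    hηt (closure_setOf_not_hasCentre_inter_regularLocus_subset htr η ρ hU hx hqt hV h)
  haveI : IsIso (ψ.f ∣_ W) := hiso W disjoint_compl_left
  exact hasCentre_join_of_isIso_morphismRestrict ψ ht W htW hA'

end Avoidance

/-! ## The measure drops -/

section Count

variable (htr : Algebra.trdeg k K = 3) {A A' B N₂ : ProjModel k K} (η : B.Hom A) (ρ : A'.Hom A)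
  (ψ : N₂.Hom B) {U : A.X.Opens} (hU : (U : Set A.X) ⊆ Scheme.regularLocus A.X) {x : A.X}
  (hx : IsBad A B U x)
  (hregU' : ∀ a' : A'.X, ρ.f a' ∈ U → IsRegularLocalRing (A'.X.presheaf.stalk a'))
  (hqt : ∀ a' : A'.X, ρ.f a' = x → IsQuadraticTransform (A.stalkSubring x) (A'.stalkSubring a'))
  {V : A.X.Opens} (hV : (closure ({x} : Set A.X))ᶜ ⊆ (V : Set A.X)) [IsIso (ρ.f ∣_ V)]
  (hiso : ∀ W : B.X.Opens, Disjoint (W : Set B.X)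
    (closure ({m : B.X | ¬ A'.HasCentre (B.stalkSubring m)} ∩ Scheme.regularLocus B.X)) →
      IsIso (ψ.f ∣_ W))

/-- The new open `U' = ρ⁻¹(U)` lies in the regular locus. [folklore] -/
theorem preimage_subset_regularLocus
    (hregU' : ∀ a' : A'.X, ρ.f a' ∈ U → IsRegularLocalRing (A'.X.presheaf.stalk a')) :
    ((ρ.f ⁻¹ᵁ U : A'.X.Opens) : Set A'.X) ⊆ Scheme.regularLocus A'.X :=
  fun a' ha' => hregU' a' ha'

include htr η hU hx hqt hV hiso in
/-- **(T1/T2) Transfer at the points of `A'` over `x` or off `cl{x}`**: every iterated quadratic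
transform of `𝒪_{A',a'}` with a centre on `B` has one on `B' = J(N₂, A')`.
[cite: Piltant2013, Lemma 5.6 (proof)] -/
theorem hasCentre_join_of_reflTransGen {a' : A'.X} (ha' : ρ.f a' = x ∨ ρ.f a' ∉ closure ({x} : Set A.X))
    {R'' : Subring K} (h : Relation.ReflTransGen IsQuadraticTransform (A'.stalkSubring a') R'')
    (hB : B.HasCentre R'') : (join N₂ A').HasCentre R'' := by
  haveI := isLocalRing_of_reflTransGen h
  obtain ⟨t, ht⟩ := hB
  have hA'c : A'.IsCentreOf R'' a' := subringDominates_of_reflTransGen h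
  have hAt : A.IsCentreOf R'' (η.f t) := ht.map η
  refine hasCentre_join_of_isCentreOf htr η ρ hU hx hqt hV ψ hiso ht ?_ ⟨a', hA'c⟩
  rcases ha' with ha' | ha'
  · -- over `x`: the centre on `A` is `x`
    have hAx : A.IsCentreOf R'' x := (hqt a' ha').dominates.trans hA'c
    rw [hAt.unique hAx]
    exact fun h => h.2 rfl
  · -- off `cl{x}`: the centre on `A` is `ρ a'`
    haveI := isIso_stalkMap_of_isIso_morphismRestrict ρ.f V a' (hV ha')
    have hAρ : A.IsCentreOf R'' (ρ.f a') := by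
      unfold IsCentreOf; rw [stalkSubring_eq_of_isIso_stalkMap ρ a']; exact hA'c
    rw [hAt.unique hAρ]
    exact fun h => ha' h.1

include htr hU hx in
/-- **(T3) Bad points of the new state lie over `x` or off `cl{x}`**: over a closed point of `U`
the fibre of `ρ` is closed inside `U'`. [cite: Piltant2013, Lemma 5.6 (proof)] -/
theorem IsBad.map_eq_or_not_mem_closure {B' : ProjModel k K} {a' : A'.X}
    (ha' : IsBad A' B' (ρ.f ⁻¹ᵁ U) a') : ρ.f a' = x ∨ ρ.f a' ∉ closure ({x} : Set A.X) := by
  by_contra h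
  push Not at h
  obtain ⟨hne, hmem⟩ := h
  rcases A.eq_or_isClosed_of_mem_closure htr (hx.coheight_eq_two htr hU) hmem with h | hcl
  · exact hne h
  · apply ha'.2.2
    have h1 : closure ({a'} : Set A'.X) ⊆ ρ.f ⁻¹' {ρ.f a'} :=
      closure_minimal (by simp) (hcl.preimage ρ.f.continuous)
    intro y hy
    have hy' : ρ.f y = ρ.f a' := h1 hy
    show ρ.f y ∈ U
    rw [hy']; exact ha'.1

include htr η hU hx hqt hV hiso in
/-- **(T4) A new bad point off `cl{x}` lies over an old bad point.** [cite: Piltant2013, Lemma 5.6 (proof)] -/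
theorem IsBad.isBad_map {a' : A'.X} (ha' : IsBad A' (join N₂ A') (ρ.f ⁻¹ᵁ U) a')
    (hC : ρ.f a' ∉ closure ({x} : Set A.X)) : IsBad A B U (ρ.f a') := by
  haveI := isIso_stalkMap_of_isIso_morphismRestrict ρ.f V a' (hV hC)
  have heq : A.stalkSubring (ρ.f a') = A'.stalkSubring a' := stalkSubring_eq_of_isIso_stalkMap ρ a'
  refine ⟨ha'.1, fun hB => ha'.2.1 ?_, fun hcl => ha'.2.2 ?_⟩
  · rw [heq] at hB
    exact hasCentre_join_of_reflTransGen htr η ρ ψ hU hx hqt hV hiso (Or.inr hC)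
      Relation.ReflTransGen.refl hB
  · have h1 : closure ({a'} : Set A'.X) ⊆ ρ.f ⁻¹' closure {ρ.f a'} :=
      closure_minimal (Set.singleton_subset_iff.mpr (subset_closure (Set.mem_singleton (ρ.f a'))))
        (isClosed_closure.preimage ρ.f.continuous)
    exact fun y hy => hcl (h1 hy)

include hV in
omit [IsIso (ρ.f ∣_ V)] in
/-- **(T7a) `ρ` is injective on the points off `cl{x}`.** [folklore] -/
theorem map_injOn_of_isIso [IsIso (ρ.f ∣_ V)] :
    Set.InjOn ρ.f {a' : A'.X | ρ.f a' ∉ closure ({x} : Set A.X)} := by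
  intro a₁ h₁ a₂ h₂ h
  have h₁V : a₁ ∈ ρ.f ⁻¹ᵁ V := hV h₁
  have h₂V : a₂ ∈ ρ.f ⁻¹ᵁ V := hV h₂
  have hval : ∀ s : (ρ.f ⁻¹ᵁ V : A'.X.Opens), ((ρ.f ∣_ V) s).1 = ρ.f s.1 := fun s =>
    morphismRestrict_base_coe ρ.f V s
  have hinj := (ConcreteCategory.bijective_of_isIso (ρ.f ∣_ V).base).1
  have heq : (ρ.f ∣_ V) ⟨a₁, h₁V⟩ = (ρ.f ∣_ V) ⟨a₂, h₂V⟩ := by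
    apply Subtype.ext; rw [hval, hval]; exact h
  exact congrArg Subtype.val (hinj heq)

omit [IsIso (ρ.f ∣_ V)] in
/-- **(T7b) A point of a model is determined by its local ring in `K`** (uniqueness of centres).
[cite: ZariskiSamuel1960, Ch. VI §17] -/
theorem stalkSubring_injective (M : ProjModel k K) : Function.Injective M.stalkSubring := by
  intro a b h
  have ha : M.IsCentreOf (M.stalkSubring a) a := M.isCentreOf_self a
  have hb : M.IsCentreOf (M.stalkSubring a) b := by rw [h]; exact M.isCentreOf_self b
  exact ha.unique hb

include htr η hU hx hregU' hqt hV hiso in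
/-- **The measure drops** (Piltant 2013, Lemma 5.6: `N_{η'} = N_η − 1`; here `≤ N_η − 1` with the
base count): bad points of `(A', ρ⁻¹U, B')` off `cl{x}` map injectively to bad points `≠ x` of
`(A, U, B)` with no larger count (transfer of centres), there are none over `cl{x} ∖ {x}`, and
those over `x` have pairwise distinct local rings which are first quadratic transforms of
`𝒪_{A,x}` without centre, whose counts sum to at most `count(x) − 1`
(`sum_baseCount_add_one_le`). [cite: Piltant2013, Lemma 5.6] -/
theorem badMeasure_lt : badMeasure A' (ρ.f ⁻¹ᵁ U) (join N₂ A') < badMeasure A U B := by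
  classical
  set B' := join N₂ A' with hB'
  set U' : A'.X.Opens := ρ.f ⁻¹ᵁ U with hU'def
  have hU' : (U' : Set A'.X) ⊆ Scheme.regularLocus A'.X := preimage_subset_regularLocus ρ hregU'
  haveI hregx : IsRegularLocalRing (A.X.presheaf.stalk x) := isRegularLocalRing_of_mem hU hx.1
  have hx2 : coheight x = 2 := hx.coheight_eq_two htr hU
  set R := A.stalkSubring x with hRdef
  -- coordinates of `B` and the dictionary `badCount B = baseCount`
  obtain ⟨n, ιB, _, hιB, w, hw, hgenB⟩ := B.exists_coords
  have hw' : ∃ i, w i ≠ 0 := by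
    by_contra h; push Not at h; exact hw (funext h)
  have hbc : ∀ {O : Subring K} [IsLocalRing O], (∀ c : k, algebraMap k K c ∈ O) →
      badCount B O = baseCount O w := fun hk => badCount_eq_baseCount B ιB hιB w hw hgenB hk
  -- the finite sets of bad points
  have hfin : {a : A.X | IsBad A B U a}.Finite := finite_setOf_isBad htr hU
  have hfin' : {a' : A'.X | IsBad A' B' U' a'}.Finite := finite_setOf_isBad htr hU'
  set S := hfin.toFinset with hSdef
  set S' := hfin'.toFinset with hS'def
  have hmS : ∀ {a}, a ∈ S ↔ IsBad A B U a := fun {a} => by rw [hSdef, Set.Finite.mem_toFinset]; rfl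
  have hmS' : ∀ {a'}, a' ∈ S' ↔ IsBad A' B' U' a' := fun {a'} => by
    rw [hS'def, Set.Finite.mem_toFinset]; rfl
  let μ : A.X → ℕ := fun a => badCount B (A.stalkSubring a)
  let μ' : A'.X → ℕ := fun a' => badCount B' (A'.stalkSubring a')
  have hM : badMeasure A U B = ∑ a ∈ S, μ a := finsum_mem_eq_finite_toFinset_sum _ hfin
  have hM' : badMeasure A' U' B' = ∑ a' ∈ S', μ' a' := finsum_mem_eq_finite_toFinset_sum _ hfin'
  rw [hM, hM']
  have hxS : x ∈ S := hmS.mpr hx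
  -- transfer inequalities
  have hfinR : (badTree B R).Finite := hx.finite_badTree A htr hU
  have htrans : ∀ a' ∈ S', μ' a' ≤ badCount B (A'.stalkSubring a') := fun a' ha' => by
    have hbad := hmS'.mp ha'
    have hcase := IsBad.map_eq_or_not_mem_closure htr ρ hU hx hbad
    refine badCount_le ?_ fun R'' h hBc =>
      hasCentre_join_of_reflTransGen htr η ρ ψ hU hx hqt hV hiso hcase h hBc
    -- finiteness of `badTree B 𝒪_{A',a'}`
    rcases hcase with h | h
    · refine hfinR.subset fun R'' hR'' => ⟨Relation.ReflTransGen.head (hqt a' h) hR''.1, hR''.2⟩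
    · haveI := isIso_stalkMap_of_isIso_morphismRestrict ρ.f V a' (hV h)
      rw [← stalkSubring_eq_of_isIso_stalkMap ρ a']
      exact (IsBad.isBad_map htr η ρ ψ hU hx hqt hV hiso hbad h).finite_badTree A htr hU
  -- split the new bad points: over `x` / off `cl{x}`
  let Sx := S'.filter fun a' => ρ.f a' = x
  let So := S'.filter fun a' => ¬ ρ.f a' = x
  have hsplit : ∑ a' ∈ S', μ' a' = ∑ a' ∈ Sx, μ' a' + ∑ a' ∈ So, μ' a' :=
    (Finset.sum_filter_add_sum_filter_not S' (fun a' => ρ.f a' = x) μ').symm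
  have hSo : ∀ a' ∈ So, IsBad A' B' U' a' ∧ ρ.f a' ∉ closure ({x} : Set A.X) := fun a' ha' => by
    rw [Finset.mem_filter] at ha'
    have hbad := hmS'.mp ha'.1
    exact ⟨hbad, (IsBad.map_eq_or_not_mem_closure htr ρ hU hx hbad).resolve_left ha'.2⟩
  have hSx : ∀ a' ∈ Sx, IsBad A' B' U' a' ∧ ρ.f a' = x := fun a' ha' => by
    rw [Finset.mem_filter] at ha'
    exact ⟨hmS'.mp ha'.1, ha'.2⟩
  /- (1) off `cl{x}`: `Σ_{So} μ' ≤ Σ_{S ∖ {x}} μ` -/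
  have h1 : ∑ a' ∈ So, μ' a' ≤ ∑ a ∈ S.erase x, μ a := by
    calc ∑ a' ∈ So, μ' a' ≤ ∑ a' ∈ So, μ (ρ.f a') := by
          refine Finset.sum_le_sum fun a' ha' => ?_
          obtain ⟨hbad, hC⟩ := hSo a' ha'
          haveI := isIso_stalkMap_of_isIso_morphismRestrict ρ.f V a' (hV hC)
          have := htrans a' (Finset.mem_of_mem_filter a' ha')
          change μ' a' ≤ badCount B (A.stalkSubring (ρ.f a'))
          rwa [stalkSubring_eq_of_isIso_stalkMap ρ a']
      _ = ∑ a ∈ So.image ρ.f, μ a := by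
          rw [Finset.sum_image]
          intro a₁ h₁ a₂ h₂ h
          exact map_injOn_of_isIso ρ hV (hSo a₁ h₁).2 (hSo a₂ h₂).2 h
      _ ≤ ∑ a ∈ S.erase x, μ a := by
          refine Finset.sum_le_sum_of_subset_of_nonneg ?_ fun _ _ _ => Nat.zero_le _
          intro a ha
          rw [Finset.mem_image] at ha
          obtain ⟨a', ha', rfl⟩ := ha
          obtain ⟨hbad, hC⟩ := hSo a' ha'
          rw [Finset.mem_erase]
          refine ⟨fun h => hC (by rw [h]; exact subset_closure (Set.mem_singleton x)), hmS.mpr ?_⟩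
          exact IsBad.isBad_map htr η ρ ψ hU hx hqt hV hiso hbad hC
  /- (2) over `x`: `Σ_{Sx} μ' + 1 ≤ μ x` -/
  have h2 : ∑ a' ∈ Sx, μ' a' + 1 ≤ μ x := by
    have hle : ∑ a' ∈ Sx, μ' a' ≤ ∑ R₁ ∈ Sx.image A'.stalkSubring, baseCount R₁ w := by
      calc ∑ a' ∈ Sx, μ' a' ≤ ∑ a' ∈ Sx, baseCount (A'.stalkSubring a') w := by
            refine Finset.sum_le_sum fun a' ha' => ?_
            have := htrans a' (Finset.mem_of_mem_filter a' ha')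
            rwa [hbc (A'.algebraMap_mem_stalkSubring a')] at this
        _ = ∑ R₁ ∈ Sx.image A'.stalkSubring, baseCount R₁ w := by
            rw [Finset.sum_image]
            exact fun a₁ _ a₂ _ h => stalkSubring_injective A' h
    have hkey : ∑ R₁ ∈ Sx.image A'.stalkSubring, baseCount R₁ w + 1 ≤ baseCount R w := by
      refine sum_baseCount_add_one_le (IsNoetherian.noetherian _)
        (maximalIdeal_ne_span_singleton (A.ringKrullDim_stalkSubring_eq_two hx2)) ?_ ?_ _ ?_
      · rw [← hasCentre_iff_definedOn B ιB hιB w hw hgenB (A.algebraMap_mem_stalkSubring x)]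
        exact hx.2.1
      · rw [← badTree_eq_baseTree B ιB hιB w hw hgenB (A.algebraMap_mem_stalkSubring x)]
        exact hfinR
      · intro R₁ hR₁
        rw [Finset.mem_image] at hR₁
        obtain ⟨a', ha', rfl⟩ := hR₁
        exact hqt a' (hSx a' ha').2
    have hμx : μ x = baseCount R w := hbc (A.algebraMap_mem_stalkSubring x)
    rw [hμx]
    omega
  -- conclusion
  rw [hsplit, ← Finset.add_sum_erase S μ hxS]
  omega

end Count

/-! ## The step -/

/-- **The inductive step of Zariski's bad-curve induction for `P = P_reg`** (Piltant 2013,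
Lemma 5.6, without the factorizability Lemma 5.3): at a bad point `x` of `(A, U, B)` there are
projective models `ρ : A' → A` (principalization of the ideal of `cl{x} ∩ U` extended to `A`)
and `B' = J(N₂, A') → B` with `Reg B` regular preimage and `B' → A'`, such that `ρ⁻¹(U) ⊆ Reg A'`
and the measure drops. [cite: Piltant2013, Lemma 5.6; CossartPiltant2019, Prop. 4.4] -/
theorem exists_step (hP : CossartPiltant2019Principalization.{u}) (htr : Algebra.trdeg k K = 3)
    {A B : ProjModel k K} (η : B.Hom A) {U : A.X.Opens}
    (hU : (U : Set A.X) ⊆ Scheme.regularLocus A.X) {x : A.X} (hx : IsBad A B U x) :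
    ∃ (A' B' : ProjModel k K) (ρ : A'.Hom A) (_ : B'.Hom A') (θ : B'.Hom B),
      θ.RegLe ∧ (∀ a' : A'.X, ρ.f a' ∈ U → IsRegularLocalRing (A'.X.presheaf.stalk a')) ∧
      badMeasure A' (ρ.f ⁻¹ᵁ U) B' < badMeasure A U B := by
  obtain ⟨A', ρ, V, hregU', hV, hisoV, hqt⟩ := exists_modification_of_isBad hP htr hU hx
  haveI := hisoV
  -- Step 2 for the pair `(A', B)`
  obtain ⟨n, ιA, _, hιA, w, hw, hgenA⟩ := A'.exists_coords
  have hdimB : topologicalKrullDim B.X = 3 := by rw [B.topologicalKrullDim_eq_of_trdeg htr]; rfl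
  obtain ⟨N₂, ψ, hreg, hiso1, -⟩ := exists_hom_regLe_isIso_of_regPrincipalization A' B ιA hιA w hw
    hgenA (regPrincipalization_of_principalization hP B hdimB)
  have hInd : {m : B.X | ¬ IsDefinedAt (fun l => B.funFieldAlgEquiv.symm (w l)) m} =
      {m | ¬ A'.HasCentre (B.stalkSubring m)} := by
    ext m
    simp only [Set.mem_setOf_eq, hasCentre_stalkSubring_iff_isDefinedAt B A' ιA hιA w hw hgenA m]
  rw [hInd] at hiso1
  refine ⟨A', join N₂ A', ρ, joinSnd N₂ A', (joinFst N₂ A').comp ψ, hreg, hregU', ?_⟩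
  exact badMeasure_lt htr η ρ ψ hU hx hregU' hqt hV hiso1

end ProjModel

end Literature.AlgebraicGeometry.Resolution

end
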